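import Summits.AtomisticToContinuum.HydrodynamicLimit.Theses.ImplosionDichotomy

/-!
# Route ImplosionDichotomy — Assembly (item stmt-AtomisticToContinuum-12592)

`Assembly := DiluteSelfConsistency → HydroLimitInBand → HydrodynamicLimit` is, verbatim, the type of the
route's deciding theorem `closes` (σ₀ := min σ₁ σ₂ bookkeeping: η₀ from `HydroLimitInBand`, σ₁ from
`HydroLimitInBand` at the given profiles, σ₂ from `DiluteSelfConsistency` at η := η₀; for σ < min σ₁ σ₂ the
dilute self-consistency supplies the packing guard on `[0,T)` and the in-band limit returns the LLN at every
`t < T`). This file closes the assembly item by that theorem.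
-/

namespace Summit.AtomisticToContinuum.HydrodynamicLimit.Theorems

open Summit.AtomisticToContinuum.HydrodynamicLimit.Theses in
/-- The assembly item of route ImplosionDichotomy: `DiluteSelfConsistency → HydroLimitInBand →
HydrodynamicLimit`, i.e. the packing-guarded conjunct together with dilute self-consistency of the
admissible classical hard-sphere-Euler solutions gives the sub-problem `HydrodynamicLimit`
(σ₀ := min of the two thresholds). Proof: unfold and apply the route's deciding theorem
`ImplosionDichotomy.closes` to the two hypotheses. -/
theorem implosionDichotomy_assembly_proof :
    Summit.AtomisticToContinuum.HydrodynamicLimit.Theses.ImplosionDichotomy.Assembly := by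
  unfold ImplosionDichotomy.Assembly
  intro hD hB
  exact ImplosionDichotomy.closes hD hB

/-! ## Restated assembly (item stmt-AtomisticToContinuum-17429, route-repair 2026-08-16, rev 11)

After the D-0032 re-type of the sub-problem Statement the route decl `Assembly` reads
`DiluteSelfConsistency → HydroLimitProfilewiseBand → HydrodynamicLimit`: the second hypothesis is now the
PROFILE-WISE packing-guarded limit (`∀ profiles ∃ η ∃ σ₀ …`, stmt-17372) instead of the uniform band
`HydroLimitInBand`. The deciding theorem `ImplosionDichotomy.closes` was re-typed in the same revision, so
the assembly is again literally its type; the theorem above (written for the pre-retype item stmt-12592)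
elaborates unchanged, and the theorem below records the restated item under its own name and docstring. -/

open Summit.AtomisticToContinuum.HydrodynamicLimit.Theses in
/-- The RESTATED assembly item of route ImplosionDichotomy (stmt-AtomisticToContinuum-17429):
`DiluteSelfConsistency → HydroLimitProfilewiseBand → HydrodynamicLimit`. Bookkeeping (σ₀ := min of the two
thresholds): for given continuous positive profiles take `η` and `σ₁` from the profile-wise band, `σ₂` from
dilute self-consistency at that `η`; for `σ < min σ₁ σ₂` every admissible classical hard-sphere-Euler
solution keeps packing `ρ_t(x)σ³ < η` on `[0,T)`, so the profile-wise band returns the LLN at every `t < T`,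
which is the unguarded limit and hence the (guarded) sub-problem `HydrodynamicLimit`. Proof: unfold and
apply the route's deciding theorem `ImplosionDichotomy.closes` (rev 11), whose type this is verbatim. -/
theorem implosionDichotomy_assembly_profilewise_proof :
    Summit.AtomisticToContinuum.HydrodynamicLimit.Theses.ImplosionDichotomy.Assembly := by
  unfold ImplosionDichotomy.Assembly
  intro hD hP
  exact ImplosionDichotomy.closes hD hP

end Summit.AtomisticToContinuum.HydrodynamicLimit.Theorems
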